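import Summits.AtomisticToContinuum.FouriersLaw.Theses.PhononLorentzGas
import HarnessLib.Audit

/-!
# Birth skeleton (BC3) — crux `DiluteBoundedResponse` (stmt-AtomisticToContinuum-12794), route `PhononLorentzGas`

`Cruxes/DiluteBoundedResponse/Lines/birth.lean` · registrar planner-skel-stmt-AtomisticToContinuum-12794-0 ·
2026-08-17 · mode skeleton-register (route re-audit bin REPAIRABLE). The crux is FIXED and is concluded BY NAME:

  `Summit.AtomisticToContinuum.FouriersLaw.Theses.PhononLorentzGas.DiluteBoundedResponse`

(rank 4, "THE RUNG": for all `ω₂ lam β γ > 0` and `T > 0` there is `ℓ₀` such that for every period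
`ℓ ≥ ℓ₀` the dilute cell chain `P_ℓ = cellChain ω₂ lam β γ (cellPeriodic ℓ)` — the `ω₂`-pinned unit-coupling
harmonic host with the conjunct's quartic terms switched on at every `ℓ`-th site — has, for all `N ≥ N₀`, SOME
finite-`N` linear-response coefficient at temperature `T` and ALL of them bounded by a constant `C(T, ℓ)`:
Ohmic, non-anomalous conduction of a deterministic Hamiltonian-bulk chain).

## The cut — three named stubs along "existence · sign · series law"

Write `IRC ℓ N T D` for `(cellChain ω₂ lam β γ (cellPeriodic ℓ)).IsResponseCoeff N T D` (`D` is a response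
coefficient of the `N`-site dilute chain at `T` along SOME weak-steady-state family) and `R_N := (N−1)/D_N` for
the finite-size RESISTANCE (BLR's `1/κ_N` up to `N/(N−1)`). The renewal / phonon-Lorentz-gas picture of the
route says: each thermalising cell re-emits an equilibrated phonon flux, so consecutive periods add their
resistances INCOHERENTLY — `R_{N+ℓ} ≈ R_N + r₁(T)` — and Ohm's law `D_N → ℓ/r₁` is the SUM of that
recursion. The skeleton makes exactly this sum the proved part and isolates three lemmas:

* `stub_diluteResponseExists` (S1, L/XL) — for every period `ℓ`, temperature `T > 0` and size `N` the dilute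
  chain HAS a response coefficient: weak steady states for all bath temperatures (a Cuneo–Eckmann–Hairer–
  Rey-Bellet-class existence theorem for the MIXED-DEGREE path network: quartic pinning + quartic right bond at
  the cells, harmonic everywhere else — outside the printed condition C3 / Rem 2.11 of CEHR2018, refuter note
  F1 on the item) and a `δ → 0` limit of the total current along some family (Hairer–Majda / Rey-Bellet
  finite-volume linear response). This is the crux's `∃`-clause, de-thresholded.
* `stub_diluteResponseNonneg` (S2, M/L) — every response coefficient of every `P_ℓ` is `≥ 0`: the Clausius
  sign of the steady current (heat flows from the hotter bath) at first order in `δT`, for EVERY weak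
  steady-state family. By the refuter's convexity lemmas (item evidence Mixture.lean: the weak class is convex,
  the current affine, a super-linear branch shifts every coefficient) this is also where the hidden
  weak-class current-uniqueness content of the crux's `∀`-clause (refuter note F2) is paid for, once.
* `stub_periodResistanceIncrement` (S3, XL, the lever) — the SERIES LAW one period at a time: for `ℓ ≥ ℓ₀(T)`
  there are `r = r(T, ℓ) > 0` and `N₀` such that for `N ≥ N₀` every coefficient `D` at size `N` and every
  `D'` at size `N + ℓ` satisfy `D'·((N−1) + r·D) ≤ (N+ℓ−1)·D`, i.e. `R_{N+ℓ} ≥ R_N + r` whenever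
  `D, D' > 0` (`increment_iff_resistance` below; the division-free form also says "zero conductance
  propagates"). Appending one period keeps the right contact in the same phase of the period, so only one
  bulk cell is added; `r` is any fixed fraction of the single-cell excess resistance `r₁(T) = (1−τ)/(τ c_∞)`.

`DiluteBoundedResponse_of : Sig.stub_diluteResponseExists → Sig.stub_diluteResponseNonneg →
Sig.stub_periodResistanceIncrement → DiluteBoundedResponse` is PROVED (§3): strong induction on the size in
steps of `ℓ` of the potential inequality `(N − N₁ − ℓ + 1)·r·D ≤ ℓ·(N − 1)` (trivial on the base window
`[N₁, N₁ + ℓ)`, propagated `N ↦ N + ℓ` by S3 fed with an S1-coefficient at the lower level and the S2 signs),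
then `N ≥ 2N₁ + 2ℓ` gives `D ≤ 2ℓ/r`; thresholds `ℓ₀' = max ℓ₀ 1`, `N₀' = 2·max N₀ 2 + 2ℓ`, `C = 2ℓ/r`.
`lean check`: sorries ONLY in the three `stub_*`.

Hardest stub: `stub_periodResistanceIncrement` — it is the N-UNIFORM statement ("beyond the kinetic window":
the residual inter-cell memory after the phonon return time `2ℓ/v_max` must not erode the per-period increment;
a PERIODIC array of STATIC scatterers would Bloch-conduct ballistically, so everything rests on the cells being
thermal, i.e. on the sister crux `CellMixing`). The kinetic-window renewal theorem of the route's two-layer plan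
(`DiluteOhmWindow`: `R_{Mℓ} = r₀ + M r₁ (1 ± ε)` for `M ≤ M_T(ℓ)`) is its quantitative refinement and is NOT
needed for boundedness, hence not a stub here. Fallback reshape if single-period monotonicity is too strong:
the ladder-averaged form `R_{N+kℓ} ≥ R_N + k r − K` (same assembly, arithmetic instead of induction).

BC3 probes (registrar, 2026-08-17, files `bc/probe_*.lean` of the registrar's folder): for each of the three
stub signatures `S`, `example : S → DiluteBoundedResponse` and `example : S → FouriersLaw` by
`first | exact? | simpa | aesop` FAIL, and `example : S` by the same tactics FAILS (no stub is cheaply the crux,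
the summit, or trivially true).

Disproof used: none exists for this crux (`ledger crux ls stmt-AtomisticToContinuum-12794`: no workfiles, no
`disproof_path` in the payload, no `Theorems/DiluteBoundedResponse/Negative/*`, 2026-08-17). Negatives index
(`ledger negatives --problem AtomisticToContinuum`, 20 entries): none concerns response coefficients of cell
chains. Refuter notes honoured: F1 (the `∃`-clause is a genuine existence theorem) = S1 verbatim; F2 (hidden
weak-uniqueness content of the `∀`-clause) = S2 is stated for ALL coefficients and is the only place a sign is
produced; the degenerate slices `ℓ = 0` (harmonic host, ballistic), `ℓ = 1` (dense chain) and `N < ℓ` are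
dodged exactly as in the crux, by the existential thresholds of S3 (`ℓ₀`, `N₀`) — S3 is FALSE at `ℓ = 0`
(take `D = D'`), which is why the assembly uses `max ℓ₀ 1`.
-/

noncomputable section

set_option linter.unusedVariables false

namespace Summit.AtomisticToContinuum.FouriersLaw.Cruxes.DiluteBoundedResponse.Birth

open Literature.MathematicalPhysics.KineticTheory.HeatConduction
open Summit.AtomisticToContinuum.FouriersLaw.Theses.PhononLorentzGas (DiluteBoundedResponse)

/-! ## §1 The registered stubs (the ONLY `sorry`s of this file; full signatures inline)

Each stub is the theorem `theorem stub_<name> : <signature> := by sorry` with a signature self-contained over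
tree declarations (`cellChain`, `cellPeriodic`, `SiteChain.IsResponseCoeff` of `CellChain.lean`), so that a
`Theorems/` file can restate and prove it verbatim (a Lines file is not importable). §2 repeats each signature,
token-identically, as the reducible alias `Sig.stub_<name>` — only the spelling of the hypotheses of
`DiluteBoundedResponse_of`, which the skeleton audit reads BY NAME (heads = stub names);
`diluteBoundedResponse_skeleton` applies `_of` to the three theorems, checking that aliases = theorem types. -/

/-- **STUB 1 — RESPONSE COEFFICIENTS OF THE DILUTE CHAINS EXIST** (the crux's `∃`-clause without thresholds).
For `ω₂, lam, β, γ > 0`, every period `ℓ`, every `T > 0` and every size `N`, the dilute cell chain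
`P_ℓ = cellChain ω₂ lam β γ (cellPeriodic ℓ)` has a finite-`N` linear-response coefficient at `T`: some family
`μ T_L T_R` of weak steady states over ALL bath temperatures `T_L, T_R > 0` (probability, `∫ L f dμ = 0` on
`C_c^∞`, bond currents integrable) along which `totalCurrent (μ (T+δ/2) (T−δ/2)) / δ` has a limit as
`δ → 0, δ ≠ 0`. Content: NESS EXISTENCE for the mixed-degree network (quartic pinning `ω₂q²/2 + lam q⁴/4` and
quartic right bond at the cells `i ≡ ℓ−1 (mod ℓ)`, harmonic pinning and bonds elsewhere; Langevin baths `γ` at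
both ends) — Lyapunov/Hörmander construction à la Cuneo–Eckmann–Hairer–Rey-Bellet 2018 Thm 2.13, whose printed
degree condition (C3, Rem 2.11) does not cover a quartic-pinned cell with a harmonic left bond — plus the
finite-volume linear response (Hairer–Majda 2009 Thm 2.3 framework; Rey-Bellet 2003 Rem 4.4). Degenerate
members are true and easy: `ℓ = 0` (pinned harmonic host: Gaussian NESS, `D = (N−1)·fluxCoeff`), `ℓ = 1`
(the dense chain = `pinnedChain`, by `cellChain_cellPeriodic_one`: in-tree `pinnedChain_exists_isSteadyState`
+ `NessUnique_holds` + `finiteResponseOfUnique_holds`), `N = 0, 1` (no bond, `D = 0`).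
Why it might fail: Hairer–Mattingly 2009 breather class — a highly excited quartic cell decouples from a
HARMONIC neighbour bond; existence of the invariant measure is open in print already for `V₁ = q⁴, V₂ = q²`
(HM2009 §1); here the cell's right bond is quartic (energy can always leave to the right), which is the bet.
Sources: CuneoEckmannHairerReyBellet2018 (Thm 2.13, Rem 2.11), HairerMattingly2009, HairerMajda2009,
ReyBellet2003, Carmona2007; refuter note F1 on stmt-12794. Size: L/XL. -/
theorem stub_diluteResponseExists :
    ∀ ω₂ lam β γ : ℝ, 0 < ω₂ → 0 < lam → 0 < β → 0 < γ → ∀ ℓ : ℕ, ∀ T : ℝ, 0 < T → ∀ N : ℕ, ∃ D : ℝ,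
    (Literature.MathematicalPhysics.KineticTheory.HeatConduction.cellChain ω₂ lam β γ
      (Literature.MathematicalPhysics.KineticTheory.HeatConduction.cellPeriodic ℓ)).IsResponseCoeff N T D := by
  sorry

/-- **STUB 2 — RESPONSE COEFFICIENTS OF THE DILUTE CHAINS ARE NONNEGATIVE** (second law at first order).
For `ω₂, lam, β, γ > 0`, every period `ℓ`, `T > 0`, size `N` and EVERY response coefficient `D` of
`P_ℓ` at `(N, T)`: `0 ≤ D`. Content: along any weak-steady-state family the total current at bath
temperatures `(T+δ/2, T−δ/2)` has the sign of `δ` (Clausius: nonnegative entropy production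
`J·(1/T_R − 1/T_L) ≥ 0` for WEAK stationary solutions of the hypoelliptic Fokker–Planck equation — the
Echeverría / FP-identification step of the in-tree `nessUnique_proof`, then Eckmann–Pillet–Rey-Bellet 1999),
so `totalCurrent/δ ≥ 0` on both sides of `0` and the limit is `≥ 0`. This is where the crux's hidden
weak-class content sits (refuter F2, evidence Mixture.lean: the weak steady-state class is convex and the
current affine, so a non-unique class with two different currents manufactures families with ANY response
coefficient — then S2, and the crux, fail together). `N = 0, 1`: `D = 0`.
Why it might fail: only through NON-UNIQUENESS of weak steady states of `P_ℓ` with distinct currents (a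
mixture branch with `current/δ → −∞`); for genuine invariant measures the sign is the second law.
Sources: EckmannPilletReyBellet1999b, BonettoLebowitzReyBellet2000 §5, CuneoEckmannHairerReyBellet2018,
Carmona2007; sibling item `MatthiessenIncrements.PositiveConductance` (strict form, dense chain). Size: M/L. -/
theorem stub_diluteResponseNonneg :
    ∀ ω₂ lam β γ : ℝ, 0 < ω₂ → 0 < lam → 0 < β → 0 < γ → ∀ ℓ : ℕ, ∀ T : ℝ, 0 < T → ∀ N : ℕ, ∀ D : ℝ,
    (Literature.MathematicalPhysics.KineticTheory.HeatConduction.cellChain ω₂ lam β γ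
      (Literature.MathematicalPhysics.KineticTheory.HeatConduction.cellPeriodic ℓ)).IsResponseCoeff N T D →
    0 ≤ D := by
  sorry

/-- **STUB 3 — THE SERIES LAW, ONE PERIOD AT A TIME** (the lever; "beyond the kinetic window" in local form).
For `ω₂, lam, β, γ > 0` and `T > 0` there is `ℓ₀` such that for every period `ℓ ≥ ℓ₀` there are `r > 0` and
`N₀` with: for all `N ≥ N₀`, every response coefficient `D` of `P_ℓ` at size `N` and every response
coefficient `D'` of `P_ℓ` at size `N + ℓ` (one more period: `ℓ − 1` harmonic sites and one quartic cell
inserted in the bulk, the right contact staying in the same phase of the period) satisfy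
`D'·((N − 1) + r·D) ≤ (N + ℓ − 1)·D` — for `D, D' > 0` exactly `R_{N+ℓ} ≥ R_N + r` with `R_N := (N−1)/D_N`
(`increment_iff_resistance`), and for `D = 0` it forces `D' ≤ 0` (an insulating chain stays insulating).
Mechanism (renewal / Hamiltonian Büttiker probe): a cell that MIXES in the thermal harmonic field (sister crux
`CellMixing`) re-emits an equilibrated phonon flux, so the added period contributes its own excess resistance
`≈ r₁(T) = (1−τ)/(τ c_∞) > 0` INCOHERENTLY, up to inter-cell memory that has died out over the flight time
`ℓ/v_max` when `ℓ ≥ ℓ₀(T)`; any `r < r₁` works for `N ≥ N₀(T, ℓ)`.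
Why it might fail: it is N-UNIFORM — for fixed `ℓ` and `N → ∞` the residual memory after the return time
`2ℓ/v_max` (band-edge tails of the lattice field decay only like `t^(-1/2)`) must not erode the increment; a
periodic array of STATIC scatterers Bloch-conducts (increments → 0), so the statement is false without cell
thermalisation; single-period monotonicity is stronger than linear growth on average (fallback: the
ladder-averaged `R_{N+kℓ} ≥ R_N + k r − K`). It is false at `ℓ = 0` (take `D = D'`: `r·D² ≤ 0` contradicts the
ballistic `D > 0`), whence `ℓ₀ ≥ 1` in any proof.
Sources: Gallavotti1969, Spohn1978, doi:10.1142/s0129055x0500242x (low-density limit for waves), Buttiker1986,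
BonettoLebowitzLukkarinen2004 (self-consistent reservoirs: series law), Dhar2008 §3.5, BricmontKupiainen2013,
arXiv:2510.20003; nearest in-tree relative: retired sibling item `MatthiessenIncrements.PrefixIncrementBounds`
(moving-interface increments at FIXED `N` — a different ladder). Size: XL (hardest). -/
theorem stub_periodResistanceIncrement :
    ∀ ω₂ lam β γ : ℝ, 0 < ω₂ → 0 < lam → 0 < β → 0 < γ → ∀ T : ℝ, 0 < T → ∃ ℓ₀ : ℕ, ∀ ℓ : ℕ, ℓ₀ ≤ ℓ →
    ∃ r : ℝ, 0 < r ∧ ∃ N₀ : ℕ, ∀ N : ℕ, N₀ ≤ N → ∀ D D' : ℝ,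
      (Literature.MathematicalPhysics.KineticTheory.HeatConduction.cellChain ω₂ lam β γ
        (Literature.MathematicalPhysics.KineticTheory.HeatConduction.cellPeriodic ℓ)).IsResponseCoeff N T D →
      (Literature.MathematicalPhysics.KineticTheory.HeatConduction.cellChain ω₂ lam β γ
        (Literature.MathematicalPhysics.KineticTheory.HeatConduction.cellPeriodic ℓ)).IsResponseCoeff
          (N + ℓ) T D' →
      D' * (((N : ℝ) - 1) + r * D) ≤ ((N : ℝ) + ℓ - 1) * D := by
  sorry

/-! ## §2 Aliases of the three signatures (token-identical; the hypotheses of `DiluteBoundedResponse_of`) -/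

/-- Alias of the signature of `stub_diluteResponseExists` (S1; token-identical text, see its docstring). -/
abbrev Sig.stub_diluteResponseExists : Prop :=
  ∀ ω₂ lam β γ : ℝ, 0 < ω₂ → 0 < lam → 0 < β → 0 < γ → ∀ ℓ : ℕ, ∀ T : ℝ, 0 < T → ∀ N : ℕ, ∃ D : ℝ,
    (Literature.MathematicalPhysics.KineticTheory.HeatConduction.cellChain ω₂ lam β γ
      (Literature.MathematicalPhysics.KineticTheory.HeatConduction.cellPeriodic ℓ)).IsResponseCoeff N T D

/-- Alias of the signature of `stub_diluteResponseNonneg` (S2; token-identical text, see its docstring). -/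
abbrev Sig.stub_diluteResponseNonneg : Prop :=
  ∀ ω₂ lam β γ : ℝ, 0 < ω₂ → 0 < lam → 0 < β → 0 < γ → ∀ ℓ : ℕ, ∀ T : ℝ, 0 < T → ∀ N : ℕ, ∀ D : ℝ,
    (Literature.MathematicalPhysics.KineticTheory.HeatConduction.cellChain ω₂ lam β γ
      (Literature.MathematicalPhysics.KineticTheory.HeatConduction.cellPeriodic ℓ)).IsResponseCoeff N T D →
    0 ≤ D

/-- Alias of the signature of `stub_periodResistanceIncrement` (S3; token-identical text, see its
docstring). -/
abbrev Sig.stub_periodResistanceIncrement : Prop :=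
  ∀ ω₂ lam β γ : ℝ, 0 < ω₂ → 0 < lam → 0 < β → 0 < γ → ∀ T : ℝ, 0 < T → ∃ ℓ₀ : ℕ, ∀ ℓ : ℕ, ℓ₀ ≤ ℓ →
    ∃ r : ℝ, 0 < r ∧ ∃ N₀ : ℕ, ∀ N : ℕ, N₀ ≤ N → ∀ D D' : ℝ,
      (Literature.MathematicalPhysics.KineticTheory.HeatConduction.cellChain ω₂ lam β γ
        (Literature.MathematicalPhysics.KineticTheory.HeatConduction.cellPeriodic ℓ)).IsResponseCoeff N T D →
      (Literature.MathematicalPhysics.KineticTheory.HeatConduction.cellChain ω₂ lam β γ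
        (Literature.MathematicalPhysics.KineticTheory.HeatConduction.cellPeriodic ℓ)).IsResponseCoeff
          (N + ℓ) T D' →
      D' * (((N : ℝ) - 1) + r * D) ≤ ((N : ℝ) + ℓ - 1) * D

/-! ## §2b Sanity of the division-free increment (proved; not used by the audit) -/

/-- For positive coefficients the increment inequality of STUB 3 IS the series law
`R_N + r ≤ R_{N+ℓ}` for the resistances `R_N = (N−1)/D`, `R_{N+ℓ} = (N+ℓ−1)/D'`. [folklore] -/
theorem increment_iff_resistance {n l r D D' : ℝ} (hD : 0 < D) (hD' : 0 < D') :
    D' * ((n - 1) + r * D) ≤ (n + l - 1) * D ↔ (n - 1) / D + r ≤ (n + l - 1) / D' := by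
  rw [div_add' _ _ _ hD.ne', div_le_div_iff₀ hD hD']
  constructor <;> intro h <;> nlinarith [h]

/-! ## §3 The composition — the crux BY NAME from the three stubs (real proof, no `sorry`) -/

/-- **The skeleton theorem.** Existence (S1), sign (S2) and the one-period series law (S3) prove the rung
`DiluteBoundedResponse` BY NAME. Proof: fix the parameters and `T`; S3 gives `ℓ₀`; for `ℓ ≥ max ℓ₀ 1` it gives
`r > 0`, `N₀`; put `N₁ = max N₀ 2`. CLAIM (strong induction on `n`): for every `n ≥ N₁` and every response
coefficient `D` at size `n`, `((n − N₁ − ℓ + 1) : ℝ)·r·D ≤ ℓ·(n − 1)` — on the base window `n < N₁ + ℓ` the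
coefficient is `≤ 0` while `D ≥ 0` (S2); for `n ≥ N₁ + ℓ` apply S3 at size `n − ℓ ≥ N₀` to an S1-coefficient
`D₀` there and to `D`, and combine with the claim at `n − ℓ` by one line of algebra (`A + r D₀ ≥ 1 > 0`).
Then for `n ≥ 2N₁ + 2ℓ` the coefficient is `≥ (n+2)/2`, so `r·D ≤ 2ℓ`, i.e. `|D| = D ≤ 2ℓ/r =: C`; the
`∃`-clause is S1. -/
theorem DiluteBoundedResponse_of :
    Sig.stub_diluteResponseExists → Sig.stub_diluteResponseNonneg →
      Sig.stub_periodResistanceIncrement → DiluteBoundedResponse := by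
  intro hE hS hI ω₂ lam β γ hω hl hβ hγ T hT
  obtain ⟨ℓ₀, hℓ₀⟩ := hI ω₂ lam β γ hω hl hβ hγ T hT
  refine ⟨max ℓ₀ 1, fun ℓ hℓ => ?_⟩
  have hℓ1 : 1 ≤ ℓ := (le_max_right _ _).trans hℓ
  obtain ⟨r, hr, N₀, hN₀⟩ := hℓ₀ ℓ ((le_max_left _ _).trans hℓ)
  -- shorthand for the dilute chain of period `ℓ` and its response coefficients at `T`
  set P : SiteChain := cellChain ω₂ lam β γ (cellPeriodic ℓ) with hP
  have hEx : ∀ n : ℕ, ∃ D : ℝ, P.IsResponseCoeff n T D := fun n =>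
    hE ω₂ lam β γ hω hl hβ hγ ℓ T hT n
  have hNn : ∀ (n : ℕ) (D : ℝ), P.IsResponseCoeff n T D → 0 ≤ D := fun n D h =>
    hS ω₂ lam β γ hω hl hβ hγ ℓ T hT n D h
  have hInc : ∀ n : ℕ, N₀ ≤ n → ∀ D D' : ℝ, P.IsResponseCoeff n T D → P.IsResponseCoeff (n + ℓ) T D' →
      D' * (((n : ℝ) - 1) + r * D) ≤ ((n : ℝ) + ℓ - 1) * D := fun n hn D D' h h' =>
    hN₀ n hn D D' h h'
  set N₁ : ℕ := max N₀ 2 with hN₁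
  have hN₁0 : N₀ ≤ N₁ := le_max_left _ _
  have hN₁2 : 2 ≤ N₁ := le_max_right _ _
  have hℓr : (1 : ℝ) ≤ (ℓ : ℝ) := by exact_mod_cast hℓ1
  -- CLAIM: the potential inequality, by strong induction on the size in steps of `ℓ`
  have claim : ∀ n : ℕ, N₁ ≤ n → ∀ D : ℝ, P.IsResponseCoeff n T D →
      ((n : ℝ) - N₁ - ℓ + 1) * r * D ≤ (ℓ : ℝ) * ((n : ℝ) - 1) := by
    intro n
    induction n using Nat.strong_induction_on with
    | _ n ih =>
      intro hn D hD
      have hD0 : 0 ≤ D := hNn n D hD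
      have hn2 : (2 : ℝ) ≤ (n : ℝ) := by exact_mod_cast hN₁2.trans hn
      by_cases hbase : n < N₁ + ℓ
      · -- base window: the coefficient `n - N₁ - ℓ + 1` is `≤ 0`
        have hcoef : ((n : ℝ) - N₁ - ℓ + 1) ≤ 0 := by
          have : (n : ℝ) + 1 ≤ (N₁ : ℝ) + ℓ := by exact_mod_cast hbase
          linarith
        have h1 : ((n : ℝ) - N₁ - ℓ + 1) * r * D ≤ 0 := by
          have : ((n : ℝ) - N₁ - ℓ + 1) * r ≤ 0 := mul_nonpos_of_nonpos_of_nonneg hcoef hr.le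
          exact mul_nonpos_of_nonpos_of_nonneg this hD0
        have h2 : (0 : ℝ) ≤ (ℓ : ℝ) * ((n : ℝ) - 1) := by
          apply mul_nonneg (by linarith) (by linarith)
        linarith
      · -- step: `n = m + ℓ` with `N₁ ≤ m < n`
        push Not at hbase
        have hℓn : ℓ ≤ n := le_trans (Nat.le_add_left ℓ N₁) hbase
        set m : ℕ := n - ℓ with hm
        have hmn : m + ℓ = n := Nat.sub_add_cancel hℓn
        have hm1 : N₁ ≤ m := by omega
        have hmlt : m < n := by omega
        have hmcast : (m : ℝ) = (n : ℝ) - ℓ := by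
          have : ((m + ℓ : ℕ) : ℝ) = (n : ℝ) := by rw [hmn]
          push_cast at this
          linarith
        -- a coefficient at the lower level, its sign, the claim there, and the increment
        obtain ⟨D₀, hD₀⟩ := hEx m
        have hD₀0 : 0 ≤ D₀ := hNn m D₀ hD₀
        have hIH : ((m : ℝ) - N₁ - ℓ + 1) * r * D₀ ≤ (ℓ : ℝ) * ((m : ℝ) - 1) := ih m hmlt hm1 D₀ hD₀
        have hD' : P.IsResponseCoeff (m + ℓ) T D := by rw [hmn]; exact hD
        have hinc : D * (((m : ℝ) - 1) + r * D₀) ≤ ((m : ℝ) + ℓ - 1) * D₀ :=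
          hInc m (hN₁0.trans hm1) D₀ D hD₀ hD'
        -- algebra: with `A := m - 1 ≥ 1`, `a := m - N₁ - ℓ + 1`: from `a r D₀ ≤ ℓ A` and
        -- `D (A + r D₀) ≤ (A + ℓ) D₀` deduce `(a + ℓ) r D ≤ ℓ (A + ℓ)`.
        have hm2 : (2 : ℝ) ≤ (m : ℝ) := by exact_mod_cast hN₁2.trans hm1
        have hApos : 0 < ((m : ℝ) - 1) + r * D₀ := by
          have : 0 ≤ r * D₀ := mul_nonneg hr.le hD₀0
          linarith
        have key : (((m : ℝ) - N₁ - ℓ + 1) + ℓ) * r * D * (((m : ℝ) - 1) + r * D₀) ≤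
            (ℓ : ℝ) * ((m : ℝ) + ℓ - 1) * (((m : ℝ) - 1) + r * D₀) := by
          have hcoef : 0 ≤ (((m : ℝ) - N₁ - ℓ + 1) + ℓ) * r := by
            apply mul_nonneg _ hr.le
            have : (N₁ : ℝ) ≤ (m : ℝ) := by exact_mod_cast hm1
            linarith
          calc (((m : ℝ) - N₁ - ℓ + 1) + ℓ) * r * D * (((m : ℝ) - 1) + r * D₀)
              = ((((m : ℝ) - N₁ - ℓ + 1) + ℓ) * r) * (D * (((m : ℝ) - 1) + r * D₀)) := by ring
            _ ≤ ((((m : ℝ) - N₁ - ℓ + 1) + ℓ) * r) * (((m : ℝ) + ℓ - 1) * D₀) :=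
                mul_le_mul_of_nonneg_left hinc hcoef
            _ = ((m : ℝ) + ℓ - 1) * ((((m : ℝ) - N₁ - ℓ + 1) * r * D₀) + (ℓ : ℝ) * (r * D₀)) := by
                ring
            _ ≤ ((m : ℝ) + ℓ - 1) * ((ℓ : ℝ) * ((m : ℝ) - 1) + (ℓ : ℝ) * (r * D₀)) := by
                apply mul_le_mul_of_nonneg_left _ (by linarith)
                linarith
            _ = (ℓ : ℝ) * ((m : ℝ) + ℓ - 1) * (((m : ℝ) - 1) + r * D₀) := by ring
        have key' : (((m : ℝ) - N₁ - ℓ + 1) + ℓ) * r * D ≤ (ℓ : ℝ) * ((m : ℝ) + ℓ - 1) :=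
          le_of_mul_le_mul_right key hApos
        -- rewrite `m = n - ℓ`
        rw [hmcast] at key'
        have e1 : (((n : ℝ) - ℓ - N₁ - ℓ + 1) + ℓ) = ((n : ℝ) - N₁ - ℓ + 1) := by ring
        have e2 : ((n : ℝ) - ℓ + ℓ - 1) = ((n : ℝ) - 1) := by ring
        rw [e1, e2] at key'
        exact key'
  -- the constants
  refine ⟨2 * ℓ / r, 2 * N₁ + 2 * ℓ, fun n hn => ⟨hEx n, fun D hD => ?_⟩⟩
  have hnN₁ : N₁ ≤ n := by omega
  have hD0 : 0 ≤ D := hNn n D hD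
  have hc := claim n hnN₁ D hD
  -- the coefficient is at least `(n + 2)/2`
  have hcoef : ((n : ℝ) + 2) / 2 ≤ ((n : ℝ) - N₁ - ℓ + 1) := by
    have : (2 : ℝ) * N₁ + 2 * ℓ ≤ (n : ℝ) := by exact_mod_cast hn
    linarith
  have hrD : r * D ≤ 2 * ℓ := by
    by_contra hcon
    push Not at hcon
    have h1 : ((n : ℝ) + 2) / 2 * (r * D) ≤ ((n : ℝ) - N₁ - ℓ + 1) * (r * D) :=
      mul_le_mul_of_nonneg_right hcoef (mul_nonneg hr.le hD0)
    have h2 : ((n : ℝ) + 2) / 2 * (2 * ℓ) < ((n : ℝ) + 2) / 2 * (r * D) := by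
      apply mul_lt_mul_of_pos_left hcon
      have : (0 : ℝ) ≤ (n : ℝ) := Nat.cast_nonneg n
      linarith
    have h3 : ((n : ℝ) - N₁ - ℓ + 1) * (r * D) = ((n : ℝ) - N₁ - ℓ + 1) * r * D := by ring
    have h4 : (ℓ : ℝ) * ((n : ℝ) - 1) < ((n : ℝ) + 2) / 2 * (2 * ℓ) := by
      have : (0 : ℝ) < (ℓ : ℝ) := by linarith
      nlinarith
    linarith
  rw [abs_of_nonneg hD0, le_div_iff₀ hr]
  linarith

/-- The crux by name, closed modulo the three registered stubs (its axiom closure contains `sorryAx` through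
the stubs only; `DiluteBoundedResponse_of` itself is sorry-free). The application also certifies that each
alias `Sig.stub_<name>` is the type of the registered theorem `stub_<name>`. -/
theorem diluteBoundedResponse_skeleton : DiluteBoundedResponse :=
  DiluteBoundedResponse_of stub_diluteResponseExists stub_diluteResponseNonneg
    stub_periodResistanceIncrement

end Summit.AtomisticToContinuum.FouriersLaw.Cruxes.DiluteBoundedResponse.Birth

end
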